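import Summits.ResolutionOfSingularities.ResolutionOfSingularities.Theorems.RadicialJungCleanModelsLogDerivationsChart
import Mathlib.RingTheory.Ideal.Maps
import HarnessLib

/-!
# The log-Jacobian content ideal grows under a point blow-up: `J(X, f, E) 𝒪_{X'} ⊆ J(X', f, E')`

Route `ResolutionOfSingularities/RadicialJung`, crux `CleanModels` (stmt-ResolutionOfSingularities-15917),
line `via-clean-models` of crux `DescentPerfectToAll` (stmt-ResolutionOfSingularities-0549): brick
K3c-iii(b) of PROGRAMME-clean-dim2 (Giraud's normal form over an ARBITRARY ground field). Helper
file (`--supports`), OURS; nothing here is a statement of Hironaka's manuscript.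

IDEAL form of Giraud 1983, Rem. 1.6 (4), in the Ω-free language (content ideal = values of
logarithmic derivations of the function field `K` preserving the ring): for subrings `R ≤ T` of `K`
(`R` the local ring downstairs, `T` the chart algebra `R[y/x]` or one of its local rings), boundary
equations `x, y ∈ R` downstairs and `x, y/x` upstairs, and `f ∈ R`: if every derivation of `K`
preserving `R` and logarithmic along `x, y` preserves `T` (true for `T = R[y/x]` by
`derivation_mapsTo_adjoin_div_of_log`, and for its localisations by
`RadicialJungCleanModelsLogDerivationsLocalization.lean`), then the extension to `T` of the
log content ideal of `f` in `R` is contained in the log content ideal of `f` in `T`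
(`map_logContentIdeal_le`). Also: a derivation of `K` preserving a subring `T` restricts to a
derivation of `T` (`exists_derivation_restrict`), so these `K`-side content ideals are the
intrinsic ones of `RadicialJungCleanModelsContentIdeal.lean` whenever `Frac T = K`.

## References
* J. Giraud, *Forme normale d'une fonction sur une surface de caractéristique positive*, Bull. Soc.
  Math. France 111 (1983), Remarque 1.6 (4). [Giraud1983]
-/

noncomputable section

set_option linter.dupNamespace false -- mandated namespace of this single-conjunct summit

namespace Summit.ResolutionOfSingularities.ResolutionOfSingularities.Theorems.RadicialJung.CleanModels

universe u

variable {K : Type u} [Field K]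

/-- **Restriction of derivations.** A derivation of `K` preserving a subring `T` restricts to a
derivation of `T`. [folklore] -/
theorem exists_derivation_restrict (T : Subring K) (D : Derivation ℤ K K) (hD : ∀ t : T, D t ∈ T) :
    ∃ D' : Derivation ℤ T T, ∀ t : T, ((D' t : T) : K) = D t := by
  let g : T →ₗ[ℤ] T :=
    { toFun := fun t => ⟨D t, hD t⟩
      map_add' := fun a b => Subtype.ext (by simp)
      map_smul' := fun n a => Subtype.ext (by simp) }
  refine ⟨Derivation.mk' g fun a b => Subtype.ext ?_, fun t => rfl⟩
  change D ((a : K) * b) = ((a • g b + b • g a : T) : K)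
  rw [Derivation.leibniz, smul_eq_mul, smul_eq_mul]
  simp [g, smul_eq_mul]

/-- **Giraud 1.6 (4), ideal form: `J(X, f, E) 𝒪_{X'} ⊆ J(X', f, E')`.** Let `R ≤ T` be subrings of
`K`, `x, y ∈ R` with `x ≠ 0`, `f ∈ R`, and assume every derivation of `K` preserving `R` and
logarithmic along `x, y` preserves `T`. Then the extension to `T` of the ideal of `R` generated by
the values `D f` of such derivations is contained in the ideal of `T` generated by the values `D f`
of the derivations of `K` preserving `T` and logarithmic along `x` and `y/x`.
[cite: Giraud1983, Rem. 1.6 (4)] -/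
theorem map_logContentIdeal_le {R T : Subring K} (hRT : R ≤ T) {x y : R} (hx : (x : K) ≠ 0)
    (hT : ∀ D : Derivation ℤ K K, (∀ r : R, D r ∈ R) → (∃ a : R, D x = a * x) →
      (∃ b : R, D y = b * y) → ∀ t : T, D t ∈ T)
    (f : R) :
    (Ideal.span {v : R | ∃ D : Derivation ℤ K K, (∀ r : R, D r ∈ R) ∧ (∃ a : R, D x = a * x) ∧
        (∃ b : R, D y = b * y) ∧ D f = v}).map (Subring.inclusion hRT) ≤
      Ideal.span {w : T | ∃ D : Derivation ℤ K K, (∀ t : T, D t ∈ T) ∧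
        (∃ c : T, D x = c * x) ∧ (∃ c : T, D ((y : K) / x) = c * ((y : K) / x)) ∧ D f = w} := by
  rw [Ideal.map_span]
  apply Ideal.span_mono
  rintro _ ⟨v, ⟨D, hD, ⟨a, hDx⟩, ⟨b, hDy⟩, hDf⟩, rfl⟩
  refine ⟨D, hT D hD ⟨a, hDx⟩ ⟨b, hDy⟩, ⟨⟨a, hRT a.2⟩, hDx⟩,
    ⟨⟨(b : K) - a, ?_⟩, derivation_apply_div_eq_of_log D hx hDx hDy⟩, ?_⟩
  · exact T.sub_mem (hRT b.2) (hRT a.2)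
  · rw [Subring.coe_inclusion, ← hDf]

end Summit.ResolutionOfSingularities.ResolutionOfSingularities.Theorems.RadicialJung.CleanModels

end
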